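import Summits.QuantumFields.QCD.Theorems.QuarksAsStableActionCriticalLineDiamagnetismCellSecondOrderDefs
import Mathlib.Analysis.CStarAlgebra.Matrix
import Literature.Computability.QuantumComplexity.PlaceGateNorm
import Literature.MathematicalPhysics.QuantumLattice.WilsonPropagatorHeavyMass

/-!
# B6 cell sub-stub `cellSecondOrder`, Aux 1: Neumann (walk) expansion of the free spin-site frequency operator
(crux `stmt-QuantumFields-9734`, decl `Summit.QuantumFields.QCD.Theses.QuarksAsStableAction.CriticalLineDiamagnetism`,
line `Sketch`, Route B step B6; sub-problem context `Summits/QuantumFields/QCD/Statement.lean`)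

For the spin-site free operator `sFree L M s₀ s₁ = 1 ⊗ N − h` of `…CellSecondOrderDefs` (on `(ℤ/L)² × Fin 4`):
* the on-site block `N = M·1 + i(s₀γ₀ + s₁γ₁)` has the two-sided inverse `CellKappa.nInv` with `‖N⁻¹‖ ≤ 1/M`
  (`N N⁻ᴴ… = ρ⁻²`, C*-identity);
* each one-direction seam-signed Wilson hop is an isometry (`hᵤᴴ hᵤ = 1`: the two Wilson projections have orthogonal
  ranges), so `‖h‖ ≤ 2` and the Neumann ratio `x = (1 ⊗ N⁻¹) h` has `‖x‖ ≤ 2/M`;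
* for `M > 2`: `sFree` is invertible, `sFree⁻¹ = Σ_{j<d} x^j (1 ⊗ N⁻¹) + x^d (Σ' x^j)(1 ⊗ N⁻¹)` for every `d`, with the tail
  bounded by `(2/M)^d (1 − 2/M)⁻¹ / M` in the `ℓ²` operator norm (registered: `cellWalkNeumann`);
-/

noncomputable section

open scoped BigOperators Matrix Kronecker ComplexConjugate Matrix.Norms.L2Operator
open Matrix Literature.MathematicalPhysics.QuantumLattice
open Summit.QuantumFields.QCD.Cruxes.CriticalLineDiamagnetism.ChessboardCellGain.CellKappa

namespace Summit.QuantumFields.QCD.Cruxes.CriticalLineDiamagnetism.ChessboardCellGain.CellWalk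

/-! ### Wilson projections -/

/-- `P₋ + P₊ = 1`. -/
theorem pMinus_add_pPlus (μ : Fin 4) : pMinus μ + pPlus μ = 1 := cellKappaDefs_anchor μ

/-- `P₋` is Hermitian. -/
theorem conjTranspose_pMinus (μ : Fin 4) : (pMinus μ)ᴴ = pMinus μ := by
  rw [pMinus, conjTranspose_smul, conjTranspose_sub, conjTranspose_one, (euclideanGamma_isHermitian μ).eq]
  congr 1
  simp

/-- `P₊` is Hermitian. -/
theorem conjTranspose_pPlus (μ : Fin 4) : (pPlus μ)ᴴ = pPlus μ := by
  rw [pPlus, conjTranspose_smul, conjTranspose_add, conjTranspose_one, (euclideanGamma_isHermitian μ).eq]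
  congr 1
  simp

/-- `P₋² = P₋`. -/
theorem pMinus_mul_pMinus (μ : Fin 4) : pMinus μ * pMinus μ = pMinus μ := by
  have h := euclideanGamma_mul_self μ
  simp only [pMinus, Matrix.smul_mul, Matrix.mul_smul, Matrix.sub_mul, Matrix.mul_sub, Matrix.one_mul,
    Matrix.mul_one, h]
  module

/-- `P₊² = P₊`. -/
theorem pPlus_mul_pPlus (μ : Fin 4) : pPlus μ * pPlus μ = pPlus μ := by
  have h := euclideanGamma_mul_self μ
  simp only [pPlus, Matrix.smul_mul, Matrix.mul_smul, Matrix.add_mul, Matrix.mul_add, Matrix.one_mul,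
    Matrix.mul_one, h]
  module

/-- `P₋ P₊ = 0`. -/
theorem pMinus_mul_pPlus (μ : Fin 4) : pMinus μ * pPlus μ = 0 := by
  have h := euclideanGamma_mul_self μ
  simp only [pMinus, pPlus, Matrix.smul_mul, Matrix.mul_smul, Matrix.sub_mul, Matrix.mul_add, Matrix.one_mul,
    Matrix.mul_one, h]
  module

/-- `P₊ P₋ = 0`. -/
theorem pPlus_mul_pMinus (μ : Fin 4) : pPlus μ * pMinus μ = 0 := by
  have h := euclideanGamma_mul_self μ
  simp only [pMinus, pPlus, Matrix.smul_mul, Matrix.mul_smul, Matrix.add_mul, Matrix.mul_sub, Matrix.one_mul,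
    Matrix.mul_one, h]
  module

/-- `‖P₋‖ ≤ 1`. -/
theorem l2_opNorm_pMinus_le (μ : Fin 4) : ‖pMinus μ‖ ≤ 1 := by
  have hsq : ‖pMinus μ‖ * ‖pMinus μ‖ = ‖pMinus μ‖ := by
    rw [← CStarRing.norm_star_mul_self, star_eq_conjTranspose, conjTranspose_pMinus, pMinus_mul_pMinus]
  by_contra h
  push Not at h
  nlinarith [norm_nonneg (pMinus μ)]

/-- `‖P₊‖ ≤ 1`. -/
theorem l2_opNorm_pPlus_le (μ : Fin 4) : ‖pPlus μ‖ ≤ 1 := by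
  have hsq : ‖pPlus μ‖ * ‖pPlus μ‖ = ‖pPlus μ‖ := by
    rw [← CStarRing.norm_star_mul_self, star_eq_conjTranspose, conjTranspose_pPlus, pPlus_mul_pPlus]
  by_contra h
  push Not at h
  nlinarith [norm_nonneg (pPlus μ)]

/-! ### The on-site block -/

/-- `(s₀γ₀ + s₁γ₁)² = (s₀² + s₁²)·1`. -/
theorem gamma01_sq (s₀ s₁ : ℝ) :
    ((((s₀ : ℝ) : ℂ)) • euclideanGamma 0 + ((s₁ : ℝ) : ℂ) • euclideanGamma 1) *
      ((((s₀ : ℝ) : ℂ)) • euclideanGamma 0 + ((s₁ : ℝ) : ℂ) • euclideanGamma 1) =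
      (((s₀ ^ 2 + s₁ ^ 2 : ℝ)) : ℂ) • (1 : Matrix (Fin 4) (Fin 4) ℂ) := by
  have h0 := euclideanGamma_mul_self 0
  have h1 := euclideanGamma_mul_self 1
  have h10 := euclideanGamma_mul_of_ne (show (1 : Fin 4) ≠ 0 by decide)
  simp only [Matrix.smul_mul, Matrix.mul_smul, Matrix.add_mul, Matrix.mul_add, h0, h1, h10, smul_neg]
  push_cast
  module

/-- `(M·1 − i(s₀γ₀ + s₁γ₁)) N = ρ²·1`. -/
theorem spin_key (M s₀ s₁ : ℝ) :
    (((M : ℝ) : ℂ) • (1 : Matrix (Fin 4) (Fin 4) ℂ) -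
        Complex.I • ((((s₀ : ℝ) : ℂ)) • euclideanGamma 0 + ((s₁ : ℝ) : ℂ) • euclideanGamma 1)) * spinN M s₀ s₁ =
      (((M ^ 2 + s₀ ^ 2 + s₁ ^ 2 : ℝ)) : ℂ) • (1 : Matrix (Fin 4) (Fin 4) ℂ) := by
  have hS := gamma01_sq s₀ s₁
  rw [spinN]
  set S := (((s₀ : ℝ) : ℂ)) • euclideanGamma 0 + ((s₁ : ℝ) : ℂ) • euclideanGamma 1
  simp only [Matrix.smul_mul, Matrix.mul_smul, Matrix.sub_mul, Matrix.mul_add, Matrix.one_mul, Matrix.mul_one, hS,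
    smul_smul]
  have hI : Complex.I * Complex.I = -1 := Complex.I_mul_I
  match_scalars <;> first | ring1 | linear_combination (-((s₀ : ℂ) ^ 2 + (s₁ : ℂ) ^ 2)) * hI

/-- `N (M·1 − i(s₀γ₀ + s₁γ₁)) = ρ²·1`. -/
theorem spin_key' (M s₀ s₁ : ℝ) :
    spinN M s₀ s₁ * (((M : ℝ) : ℂ) • (1 : Matrix (Fin 4) (Fin 4) ℂ) -
        Complex.I • ((((s₀ : ℝ) : ℂ)) • euclideanGamma 0 + ((s₁ : ℝ) : ℂ) • euclideanGamma 1)) =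
      (((M ^ 2 + s₀ ^ 2 + s₁ ^ 2 : ℝ)) : ℂ) • (1 : Matrix (Fin 4) (Fin 4) ℂ) := by
  have hS := gamma01_sq s₀ s₁
  rw [spinN]
  set S := (((s₀ : ℝ) : ℂ)) • euclideanGamma 0 + ((s₁ : ℝ) : ℂ) • euclideanGamma 1
  simp only [Matrix.smul_mul, Matrix.mul_smul, Matrix.add_mul, Matrix.mul_sub, Matrix.one_mul, Matrix.mul_one, hS,
    smul_smul]
  have hI : Complex.I * Complex.I = -1 := Complex.I_mul_I
  match_scalars <;> first | ring1 | linear_combination (-((s₀ : ℂ) ^ 2 + (s₁ : ℂ) ^ 2)) * hI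

/-- `N⁻¹ N = 1`. -/
theorem nInv_mul_spinN (M s₀ s₁ : ℝ) (h : M ^ 2 + s₀ ^ 2 + s₁ ^ 2 ≠ 0) : nInv M s₀ s₁ * spinN M s₀ s₁ = 1 := by
  rw [nInv, Matrix.smul_mul, spin_key, smul_smul]
  have : (((1 / (M ^ 2 + s₀ ^ 2 + s₁ ^ 2) : ℝ)) : ℂ) * (((M ^ 2 + s₀ ^ 2 + s₁ ^ 2 : ℝ)) : ℂ) = 1 := by
    rw [← Complex.ofReal_mul, one_div_mul_cancel h, Complex.ofReal_one]
  rw [this, one_smul]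

/-- `N N⁻¹ = 1`. -/
theorem spinN_mul_nInv (M s₀ s₁ : ℝ) (h : M ^ 2 + s₀ ^ 2 + s₁ ^ 2 ≠ 0) : spinN M s₀ s₁ * nInv M s₀ s₁ = 1 := by
  rw [nInv, Matrix.mul_smul, spin_key', smul_smul]
  have : (((1 / (M ^ 2 + s₀ ^ 2 + s₁ ^ 2) : ℝ)) : ℂ) * (((M ^ 2 + s₀ ^ 2 + s₁ ^ 2 : ℝ)) : ℂ) = 1 := by
    rw [← Complex.ofReal_mul, one_div_mul_cancel h, Complex.ofReal_one]
  rw [this, one_smul]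

/-- `(N⁻¹)ᴴ = ρ⁻² N`. -/
theorem conjTranspose_nInv (M s₀ s₁ : ℝ) :
    (nInv M s₀ s₁)ᴴ = (((1 / (M ^ 2 + s₀ ^ 2 + s₁ ^ 2) : ℝ)) : ℂ) • spinN M s₀ s₁ := by
  rw [nInv, spinN, conjTranspose_smul, conjTranspose_sub, conjTranspose_smul, conjTranspose_smul, conjTranspose_one,
    conjTranspose_add, conjTranspose_smul, conjTranspose_smul, (euclideanGamma_isHermitian 0).eq,
    (euclideanGamma_isHermitian 1).eq]
  simp only [Complex.star_def, Complex.conj_ofReal, Complex.conj_I, neg_smul, sub_neg_eq_add]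

/-- `N⁻¹ (N⁻¹)ᴴ = ρ⁻² · 1`. -/
theorem nInv_mul_conjTranspose (M s₀ s₁ : ℝ) (h : M ^ 2 + s₀ ^ 2 + s₁ ^ 2 ≠ 0) :
    nInv M s₀ s₁ * (nInv M s₀ s₁)ᴴ = (((1 / (M ^ 2 + s₀ ^ 2 + s₁ ^ 2) : ℝ)) : ℂ) • (1 : Matrix (Fin 4) (Fin 4) ℂ) := by
  rw [conjTranspose_nInv, Matrix.mul_smul, nInv_mul_spinN M s₀ s₁ h]

/-- `‖N⁻¹‖ ≤ 1/M` for `M > 0` (indeed `‖N⁻¹‖ = 1/ρ`). -/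
theorem l2_opNorm_nInv_le (M s₀ s₁ : ℝ) (hM : 0 < M) : ‖nInv M s₀ s₁‖ ≤ 1 / M := by
  have hρ : 0 < M ^ 2 + s₀ ^ 2 + s₁ ^ 2 := by positivity
  have hone : ‖(1 : Matrix (Fin 4) (Fin 4) ℂ)‖ ≤ 1 := by
    rw [Matrix.cstar_norm_def, map_one]; exact ContinuousLinearMap.norm_id_le
  have hsq : ‖nInv M s₀ s₁‖ ^ 2 ≤ (1 / M) ^ 2 := by
    rw [sq, ← CStarRing.norm_self_mul_star, star_eq_conjTranspose, nInv_mul_conjTranspose M s₀ s₁ hρ.ne', norm_smul,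
      Complex.norm_real, Real.norm_eq_abs, abs_of_pos (by positivity)]
    have h1 : 1 / (M ^ 2 + s₀ ^ 2 + s₁ ^ 2) ≤ (1 / M) ^ 2 := by
      rw [_root_.one_div_pow]
      exact one_div_le_one_div_of_le (by positivity) (by nlinarith)
    calc 1 / (M ^ 2 + s₀ ^ 2 + s₁ ^ 2) * ‖(1 : Matrix (Fin 4) (Fin 4) ℂ)‖ ≤ 1 / (M ^ 2 + s₀ ^ 2 + s₁ ^ 2) * 1 := by
          gcongr
      _ ≤ (1 / M) ^ 2 := by rw [mul_one]; exact h1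
  exact (pow_le_pow_iff_left₀ (norm_nonneg _) (by positivity) two_ne_zero).1 hsq

/-! ### The hop: two isometries -/

variable {L : ℕ} [NeZero L]

/-- The forward shift with unit signs is an isometry. -/
theorem shiftFwd_isometry (e : ZMod L × ZMod L) (s : ZMod L × ZMod L → ℂ) (hs : ∀ x, s x = 1 ∨ s x = -1) :
    (Matrix.of fun x y : ZMod L × ZMod L => if y = x + e then s x else 0)ᴴ *
      (Matrix.of fun x y : ZMod L × ZMod L => if y = x + e then s x else 0) = 1 := by
  ext y y'
  simp only [Matrix.mul_apply, conjTranspose_apply, of_apply, Matrix.one_apply]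
  have key : ∀ x : ZMod L × ZMod L, star (if y = x + e then s x else 0) * (if y' = x + e then s x else 0) =
      if x = y - e then (if y = y' then 1 else 0) else 0 := by
    intro x
    by_cases hx : x = y - e
    · subst hx
      simp only [sub_add_cancel, if_true]
      by_cases hy : y = y'
      · subst hy; simp only [if_true]
        rcases hs (y - e) with h | h <;> simp [h]
      · rw [if_neg (fun h => hy h.symm), mul_zero, if_neg hy]
    · have : ¬ y = x + e := fun h' => hx (by rw [h', add_sub_cancel_right])
      simp [this, hx]
  simp_rw [key]
  rw [Finset.sum_ite_eq' Finset.univ (y - e)]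
  simp

/-- The backward shift with unit signs is an isometry. -/
theorem shiftBwd_isometry (e : ZMod L × ZMod L) (s : ZMod L × ZMod L → ℂ) (hs : ∀ x, s x = 1 ∨ s x = -1) :
    (Matrix.of fun x y : ZMod L × ZMod L => if x = y + e then s y else 0)ᴴ *
      (Matrix.of fun x y : ZMod L × ZMod L => if x = y + e then s y else 0) = 1 := by
  ext y y'
  simp only [Matrix.mul_apply, conjTranspose_apply, of_apply, Matrix.one_apply]
  have key : ∀ x : ZMod L × ZMod L, star (if x = y + e then s y else 0) * (if x = y' + e then s y' else 0) =
      if x = y + e then (if y = y' then 1 else 0) else 0 := by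
    intro x
    by_cases hx : x = y + e
    · subst hx
      simp only [if_true]
      by_cases hy : y = y'
      · subst hy; simp only [if_true]
        rcases hs y with h | h <;> simp [h]
      · rw [if_neg ?_, mul_zero, if_neg hy]
        intro h'; exact hy (add_right_cancel h')
    · simp [hx]
  simp_rw [key]
  rw [Finset.sum_ite_eq' Finset.univ (y + e)]
  simp

/-- **A one-direction seam-signed Wilson hop is an isometry**: `hᵤᴴ hᵤ = 1`. -/
theorem conjTranspose_dirHop_mul_self (e : ZMod L × ZMod L) (s : ZMod L × ZMod L → ℂ) (hs : ∀ x, s x = 1 ∨ s x = -1)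
    (μ : Fin 4) : (dirHop L e s μ)ᴴ * dirHop L e s μ = 1 := by
  rw [dirHop, conjTranspose_add, conjTranspose_kronecker, conjTranspose_kronecker, conjTranspose_pMinus,
    conjTranspose_pPlus, Matrix.add_mul, Matrix.mul_add, Matrix.mul_add, ← mul_kronecker_mul, ← mul_kronecker_mul,
    ← mul_kronecker_mul, ← mul_kronecker_mul, pMinus_mul_pMinus, pPlus_mul_pPlus, pMinus_mul_pPlus, pPlus_mul_pMinus,
    kronecker_zero, kronecker_zero, add_zero, zero_add, shiftFwd_isometry e s hs, shiftBwd_isometry e s hs,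
    ← kronecker_add, pMinus_add_pPlus, one_kronecker_one]

omit [NeZero L] in
/-- The seam sign is `±1`. -/
theorem seam_cases (a : ZMod L) : seam a = 1 ∨ seam a = -1 := by
  unfold seam; split_ifs <;> simp

/-- `‖hᵤ‖ ≤ 1`. -/
theorem l2_opNorm_dirHop_le (e : ZMod L × ZMod L) (s : ZMod L × ZMod L → ℂ) (hs : ∀ x, s x = 1 ∨ s x = -1)
    (μ : Fin 4) : ‖dirHop L e s μ‖ ≤ 1 := by
  have hone : ‖(1 : Matrix ((ZMod L × ZMod L) × Fin 4) ((ZMod L × ZMod L) × Fin 4) ℂ)‖ ≤ 1 := by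
    rw [Matrix.cstar_norm_def, map_one]
    exact ContinuousLinearMap.norm_id_le
  have hsq : ‖dirHop L e s μ‖ * ‖dirHop L e s μ‖ ≤ 1 := by
    rw [← CStarRing.norm_star_mul_self, star_eq_conjTranspose, conjTranspose_dirHop_mul_self e s hs]
    exact hone
  nlinarith [norm_nonneg (dirHop L e s μ)]

/-- `‖h‖ ≤ 2`. -/
theorem l2_opNorm_sHopTot_le : ‖sHopTot L‖ ≤ 2 := by
  rw [sHopTot]
  refine (norm_add_le _ _).trans ?_
  have h1 := l2_opNorm_dirHop_le (L := L) (1, 0) (fun x => seam x.1) (fun x => seam_cases x.1) 2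
  have h2 := l2_opNorm_dirHop_le (L := L) (0, 1) (fun x => seam x.2) (fun x => seam_cases x.2) 3
  linarith

/-- `‖1 ⊗ A‖ ≤ ‖A‖` (block-diagonal lift). -/
theorem l2_opNorm_one_kronecker_le {K : Type} [Fintype K] [DecidableEq K] (A : Matrix K K ℂ) :
    ‖(1 : Matrix (ZMod L × ZMod L) (ZMod L × ZMod L) ℂ) ⊗ₖ A‖ ≤ ‖A‖ := by
  have : (1 : Matrix (ZMod L × ZMod L) (ZMod L × ZMod L) ℂ) ⊗ₖ A =
      Matrix.reindex (Equiv.prodComm _ _) (Equiv.prodComm _ _)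
        (A ⊗ₖ (1 : Matrix (ZMod L × ZMod L) (ZMod L × ZMod L) ℂ)) := by
    ext ⟨x, i⟩ ⟨y, k⟩
    simp [kroneckerMap_apply, Matrix.one_apply, mul_comm]
  rw [this, Literature.Computability.QuantumComplexity.l2_opNorm_reindex]
  exact Literature.Computability.QuantumComplexity.l2_opNorm_kronecker_one_le A

/-! ### The Neumann series -/

/-- `‖x‖ ≤ 2/M`. -/
theorem l2_opNorm_xHop_le (M s₀ s₁ : ℝ) (hM : 0 < M) : ‖xHop L M s₀ s₁‖ ≤ 2 / M := by
  rw [xHop]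
  refine (Matrix.l2_opNorm_mul _ _).trans ?_
  have h1 := (l2_opNorm_one_kronecker_le (L := L) (nInv M s₀ s₁)).trans (l2_opNorm_nInv_le M s₀ s₁ hM)
  have h2 := l2_opNorm_sHopTot_le (L := L)
  calc ‖(1 : Matrix (ZMod L × ZMod L) (ZMod L × ZMod L) ℂ) ⊗ₖ CellKappa.nInv M s₀ s₁‖ * ‖sHopTot L‖
      ≤ (1 / M) * 2 := mul_le_mul h1 h2 (norm_nonneg _) (by positivity)
    _ = 2 / M := by ring

/-- `(1 ⊗ N)(1 − x) = sFree`. -/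
theorem one_kronecker_spinN_mul (M s₀ s₁ : ℝ) (h : M ^ 2 + s₀ ^ 2 + s₁ ^ 2 ≠ 0) :
    ((1 : Matrix (ZMod L × ZMod L) (ZMod L × ZMod L) ℂ) ⊗ₖ spinN M s₀ s₁) * (1 - xHop L M s₀ s₁) = sFree L M s₀ s₁ := by
  rw [Matrix.mul_sub, Matrix.mul_one, xHop, ← Matrix.mul_assoc, ← mul_kronecker_mul, Matrix.one_mul,
    spinN_mul_nInv M s₀ s₁ h, one_kronecker_one, Matrix.one_mul, sFree]

/-- The Neumann right inverse: `sFree · ((Σ' x^j)(1 ⊗ N⁻¹)) = 1` when `‖x‖ < 1`. -/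
theorem sFree_mul_neumann (M s₀ s₁ : ℝ) (h : M ^ 2 + s₀ ^ 2 + s₁ ^ 2 ≠ 0) (hx : ‖xHop L M s₀ s₁‖ < 1) :
    sFree L M s₀ s₁ * ((∑' j : ℕ, xHop L M s₀ s₁ ^ j) *
      ((1 : Matrix (ZMod L × ZMod L) (ZMod L × ZMod L) ℂ) ⊗ₖ CellKappa.nInv M s₀ s₁)) = 1 := by
  rw [← one_kronecker_spinN_mul M s₀ s₁ h, Matrix.mul_assoc, ← Matrix.mul_assoc (1 - xHop L M s₀ s₁),
    mul_neg_geom_series _ hx, Matrix.one_mul, ← mul_kronecker_mul, Matrix.one_mul, spinN_mul_nInv M s₀ s₁ h,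
    one_kronecker_one]

/-- `sFree⁻¹ = Σ_{j<d} x^j (1 ⊗ N⁻¹) + x^d (Σ' x^j)(1 ⊗ N⁻¹)` for every truncation order `d`. -/
theorem sFree_inv_eq (M s₀ s₁ : ℝ) (h : M ^ 2 + s₀ ^ 2 + s₁ ^ 2 ≠ 0) (hx : ‖xHop L M s₀ s₁‖ < 1) (d : ℕ) :
    (sFree L M s₀ s₁)⁻¹ = (∑ j ∈ Finset.range d, xHop L M s₀ s₁ ^ j *
        ((1 : Matrix (ZMod L × ZMod L) (ZMod L × ZMod L) ℂ) ⊗ₖ CellKappa.nInv M s₀ s₁)) +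
      xHop L M s₀ s₁ ^ d * ((∑' j : ℕ, xHop L M s₀ s₁ ^ j) *
        ((1 : Matrix (ZMod L × ZMod L) (ZMod L × ZMod L) ℂ) ⊗ₖ CellKappa.nInv M s₀ s₁)) := by
  rw [Matrix.inv_eq_right_inv (sFree_mul_neumann M s₀ s₁ h hx)]
  conv_lhs => rw [geom_series_eq_sum_add_pow_mul (mul_neg_geom_series _ hx) d]
  rw [Matrix.add_mul, Finset.sum_mul, Matrix.mul_assoc]

/-- `sFree` is invertible. -/
theorem isUnit_det_sFree (M s₀ s₁ : ℝ) (h : M ^ 2 + s₀ ^ 2 + s₁ ^ 2 ≠ 0) (hx : ‖xHop L M s₀ s₁‖ < 1) :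
    IsUnit (sFree L M s₀ s₁).det := by
  have hm := congrArg Matrix.det (sFree_mul_neumann M s₀ s₁ h hx)
  rw [Matrix.det_mul, Matrix.det_one] at hm
  exact (left_ne_zero_of_mul_eq_one hm).isUnit

/-- The Neumann tail: `‖x^d (Σ' x^j)(1 ⊗ N⁻¹)‖ ≤ q^d (1 − q)⁻¹ / M` for `‖x‖ ≤ q < 1`. -/
theorem l2_opNorm_tail_le (M s₀ s₁ : ℝ) (hM : 0 < M) {q : ℝ} (hxq : ‖xHop L M s₀ s₁‖ ≤ q) (hq : q < 1) (d : ℕ) :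
    ‖xHop L M s₀ s₁ ^ d * ((∑' j : ℕ, xHop L M s₀ s₁ ^ j) *
        ((1 : Matrix (ZMod L × ZMod L) (ZMod L × ZMod L) ℂ) ⊗ₖ CellKappa.nInv M s₀ s₁))‖ ≤
      q ^ d * (1 - q)⁻¹ * (1 / M) := by
  have hq0 : 0 ≤ q := (norm_nonneg _).trans hxq
  have hx1 : ‖xHop L M s₀ s₁‖ < 1 := hxq.trans_lt hq
  have hone : ‖(1 : Matrix ((ZMod L × ZMod L) × Fin 4) ((ZMod L × ZMod L) × Fin 4) ℂ)‖ ≤ 1 := by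
    rw [Matrix.cstar_norm_def, map_one]; exact ContinuousLinearMap.norm_id_le
  have hS : ‖∑' j : ℕ, xHop L M s₀ s₁ ^ j‖ ≤ (1 - q)⁻¹ := by
    refine (tsum_geometric_le_of_norm_lt_one _ hx1).trans ?_
    have h2 : (1 - ‖xHop L M s₀ s₁‖)⁻¹ ≤ (1 - q)⁻¹ := inv_anti₀ (by linarith) (by linarith)
    linarith
  have hxd : ‖xHop L M s₀ s₁ ^ d‖ ≤ q ^ d := by
    rcases Nat.eq_zero_or_pos d with h0 | hpos
    · rw [h0, pow_zero, pow_zero]; exact hone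
    · exact (norm_pow_le' _ hpos).trans (pow_le_pow_left₀ (norm_nonneg _) hxq d)
  have hN := (l2_opNorm_one_kronecker_le (L := L) (nInv M s₀ s₁)).trans (l2_opNorm_nInv_le M s₀ s₁ hM)
  have hq1 : 0 ≤ (1 - q)⁻¹ := inv_nonneg.2 (by linarith)
  calc _ ≤ ‖xHop L M s₀ s₁ ^ d‖ * ‖(∑' j : ℕ, xHop L M s₀ s₁ ^ j) *
        ((1 : Matrix (ZMod L × ZMod L) (ZMod L × ZMod L) ℂ) ⊗ₖ CellKappa.nInv M s₀ s₁)‖ := norm_mul_le _ _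
    _ ≤ ‖xHop L M s₀ s₁ ^ d‖ * (‖∑' j : ℕ, xHop L M s₀ s₁ ^ j‖ *
        ‖(1 : Matrix (ZMod L × ZMod L) (ZMod L × ZMod L) ℂ) ⊗ₖ CellKappa.nInv M s₀ s₁‖) := by
      gcongr; exact norm_mul_le _ _
    _ ≤ q ^ d * ((1 - q)⁻¹ * (1 / M)) := by gcongr
    _ = q ^ d * (1 - q)⁻¹ * (1 / M) := by ring

/-- The full inverse: `‖sFree⁻¹‖ ≤ (1 − q)⁻¹ / M`. -/
theorem l2_opNorm_sFree_inv_le (M s₀ s₁ : ℝ) (hM : 0 < M) {q : ℝ} (hxq : ‖xHop L M s₀ s₁‖ ≤ q) (hq : q < 1) :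
    ‖(sFree L M s₀ s₁)⁻¹‖ ≤ (1 - q)⁻¹ * (1 / M) := by
  have h : M ^ 2 + s₀ ^ 2 + s₁ ^ 2 ≠ 0 := by positivity
  have hx1 : ‖xHop L M s₀ s₁‖ < 1 := hxq.trans_lt hq
  have := l2_opNorm_tail_le M s₀ s₁ hM hxq hq 0
  simp only [pow_zero, one_mul] at this
  rwa [sFree_inv_eq M s₀ s₁ h hx1 0, Finset.range_zero, Finset.sum_empty, zero_add, pow_zero, Matrix.one_mul]

/-! ### Registered summary -/

/-- **Aux theorem `cellWalkNeumann`** (registered helper of `cellSecondOrder`): for `M > 2` the Neumann ratio has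
`‖x‖ ≤ 2/M < 1`, the spin-site free operator is invertible, and for every truncation order `d` its inverse is the walk sum
of lengths `< d` plus a tail of operator norm at most `(2/M)^d (1 − 2/M)⁻¹ / M`. -/
theorem cellWalkNeumann : ∀ (L : ℕ) [NeZero L] (M s₀ s₁ : ℝ), 2 < M → ‖xHop L M s₀ s₁‖ ≤ 2 / M ∧ IsUnit (sFree L M s₀ s₁).det ∧ ∀ d : ℕ, (sFree L M s₀ s₁)⁻¹ = (∑ j ∈ Finset.range d, xHop L M s₀ s₁ ^ j * Matrix.kroneckerMap (fun x1 x2 => x1 * x2) (1 : Matrix (ZMod L × ZMod L) (ZMod L × ZMod L) ℂ) (CellKappa.nInv M s₀ s₁)) + xHop L M s₀ s₁ ^ d * ((∑' j : ℕ, xHop L M s₀ s₁ ^ j) * Matrix.kroneckerMap (fun x1 x2 => x1 * x2) (1 : Matrix (ZMod L × ZMod L) (ZMod L × ZMod L) ℂ) (CellKappa.nInv M s₀ s₁)) ∧ ‖xHop L M s₀ s₁ ^ d * ((∑' j : ℕ, xHop L M s₀ s₁ ^ j) * Matrix.kroneckerMap (fun x1 x2 => x1 * x2) (1 : Matrix (ZMod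 L × ZMod L) (ZMod L × ZMod L) ℂ) (CellKappa.nInv M s₀ s₁))‖ ≤ (2 / M) ^ d * (1 - 2 / M)⁻¹ * (1 / M) := by
  intro L _ M s₀ s₁ hM
  have hM0 : 0 < M := by linarith
  have h : M ^ 2 + s₀ ^ 2 + s₁ ^ 2 ≠ 0 := by positivity
  have hxq := l2_opNorm_xHop_le (L := L) M s₀ s₁ hM0
  have hq : 2 / M < 1 := (div_lt_one hM0).2 hM
  have hx1 : ‖xHop L M s₀ s₁‖ < 1 := hxq.trans_lt hq
  exact ⟨hxq, isUnit_det_sFree M s₀ s₁ h hx1, fun d =>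
    ⟨sFree_inv_eq M s₀ s₁ h hx1 d, l2_opNorm_tail_le M s₀ s₁ hM0 hxq hq d⟩⟩

end Summit.QuantumFields.QCD.Cruxes.CriticalLineDiamagnetism.ChessboardCellGain.CellWalk

end
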